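import Literature.AlgebraicGeometry.Motives.AlgebraicEquivalencePushforwardFacts
import HarnessLib

/-!
# Push-forward of fibre cycles: reduction to the morphism of fibres `p_t : W_t ⟶ W'_t`

Second step (after `Motives/AlgebraicEquivalenceFamilyFiber`) towards the named fact
`map_familyFiberCycle_eq_finrank_smul` of `Motives/AlgebraicEquivalencePushforwardFacts`
(Fulton, *Intersection Theory*, Prop. 10.1 (a) for the generators of algebraic equivalence, as an
identity of cycles `f_* [W_t] = deg(W/W') [W'_t]` on `Y`).  For `f : X ⟶ Y` proper over `k`, a
family `W ↪ X ×ₖ T`, its image `W' = (f × 1_T)(W) ↪ Y ×ₖ T` and `t ∈ T(k)`, the morphism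
`f × 1_T` induces a proper morphism of fibres `p_t : W_t ⟶ W'_t` (`familyFiberMap`; Fulton §10.1,
"`f_t : X_t → Y_t` the induced morphism on fibres") with `p_t ≫ ι'_t = ι_t ≫ f` for the
embeddings `ι_t : W_t ↪ X`, `ι'_t : W'_t ↪ Y`.  Since `[W_t] = (ι_t)_* [W_t]` and push-forward of
cycles is functorial (Stacks 02R5, `algebraicCycleMap_comp`) and additive, the identity
`f_* [W_t] = m • [W'_t]` in `Z_* Y` follows from the identity of cycles
`(p_t)_* [W_t] = m • [W'_t]` **on the scheme `W'_t`** (fundamental cycles of the fibre schemes):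
`map_familyFiberCycle_eq_nsmul_of_fibre`.  The latter identity is the subject of the remaining
steps (lengths of the local rings of `W_t`, `W'_t` over the codimension-one points of `W'`,
Fulton App. A.1–A.3: `Literature/RingTheory/Length/Semilocal`, `…/OneDimensionalDomain`).

## Main definitions and results

* `Literature.AlgebraicGeometry.Motives.familyFiberMap f W t : W_t ⟶ W'_t`, with
  `familyFiberMap_ι` (`p_t ≫ ι'_t = ι_t ≫ f`), `familyFiberMap_fst` (compatibility with
  `W_t → W`, `W'_t → W'` and `p : W → W'`), `isProper_familyFiberMap`.
* `Literature.AlgebraicGeometry.Motives.algebraicCycleMap_nsmul`.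
* `Literature.AlgebraicGeometry.Motives.map_familyFiberCycle_eq_nsmul_of_fibre`: the reduction.

## References

* W. Fulton, *Intersection Theory*, 2nd ed. (1998), §1.4, §10.1 (Prop. 10.1 (a)).
* The Stacks Project, Tag 02R5 (functoriality of proper push-forward).
-/

universe u

open CategoryTheory AlgebraicGeometry Limits MonoidalCategory Order

noncomputable section

namespace Literature.AlgebraicGeometry.Motives

section FibreMap

variable {k : Type u} [Field k] {X Y T : SchemeOver k} (f : X ⟶ Y) [IsProper f.left]
  (W : ClosedSubvariety (X ⊗ T).left) (t : AlgPoints T k)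

/-- **The morphism of fibres `p_t : W_t ⟶ W'_t`** induced by `f × 1_T` between the fibre of a
family `W ↪ X ×ₖ T` and the fibre of its image `W' = (f × 1_T)(W) ↪ Y ×ₖ T` at `t ∈ T(k)`
(Fulton, *Intersection Theory*, §10.1, "`f_t : X_t → Y_t` the induced morphism on fibres"):
the map of pullbacks induced by `W → W'`, `f : X → Y` and `f × 1_T`. [folklore] -/
def familyFiberMap :
    (familyFiber W.toClosedSubscheme t).carrier ⟶
      (familyFiber (W.image (f ▷ T).left).toClosedSubscheme t).carrier :=
  pullback.map W.ι (sliceAt X t).left (W.image (f ▷ T).left).ι (sliceAt Y t).left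
    (W.toImage (f ▷ T).left) f.left (f ▷ T).left (W.toImage_ι (f ▷ T).left).symm
    (by rw [← Over.comp_left, sliceAt_whiskerRight, Over.comp_left])

/-- `p_t` commutes with the embeddings of the fibres into `X` and `Y`: `p_t ≫ ι'_t = ι_t ≫ f`.
[folklore] -/
@[reassoc]
lemma familyFiberMap_ι :
    familyFiberMap f W t ≫ (familyFiber (W.image (f ▷ T).left).toClosedSubscheme t).ι =
      (familyFiber W.toClosedSubscheme t).ι ≫ f.left :=
  pullback.lift_snd _ _ _

/-- `p_t` commutes with the projections to `W` and `W'`: `p_t ≫ (W'_t → W') = (W_t → W) ≫ p`.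
[folklore] -/
@[reassoc]
lemma familyFiberMap_fst :
    familyFiberMap f W t ≫ pullback.fst (W.image (f ▷ T).left).ι (sliceAt Y t).left =
      pullback.fst W.ι (sliceAt X t).left ≫ W.toImage (f ▷ T).left :=
  pullback.lift_fst _ _ _

/-- `p_t : W_t ⟶ W'_t` is proper (`p_t ≫ ι'_t = ι_t ≫ f` is proper and `ι'_t` is separated).
[folklore] -/
instance isProper_familyFiberMap : IsProper (familyFiberMap f W t) := by
  haveI : IsProper (familyFiberMap f W t ≫
      (familyFiber (W.image (f ▷ T).left).toClosedSubscheme t).ι) := by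
    rw [familyFiberMap_ι]; infer_instance
  exact IsProper.of_comp (familyFiberMap f W t)
    (familyFiber (W.image (f ▷ T).left).toClosedSubscheme t).ι

end FibreMap

section Reduction

variable {k : Type u} [Field k] {X Y T : SchemeOver k}

/-- Push-forward of cycles commutes with multiples. [folklore] -/
lemma algebraicCycleMap_nsmul {X' Y' : Scheme.{u}} (g : X' ⟶ Y') [QuasiCompact g] {N : Type*}
    [DecidableEq N] (wx : X' → N) (wy : Y' → N) (m : ℕ) (c : AlgebraicCycle X' ℤ) :
    AlgebraicCycle.map g wx wy (m • c) = m • AlgebraicCycle.map g wx wy c := by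
  induction m with
  | zero => rw [zero_smul, zero_smul, algebraicCycleMap_zero]
  | succ m ih => rw [succ_nsmul, succ_nsmul, algebraicCycleMap_add, ih]

/-- **Reduction of Fulton's Prop. 10.1 (a) for the generators to the fibre schemes.**  For
`f : X ⟶ Y` proper, a family `W ↪ X ×ₖ T`, its image `W' = (f × 1_T)(W)` and `t ∈ T(k)`: if the
proper morphism of fibres `p_t : W_t ⟶ W'_t` (`familyFiberMap`) pushes the fundamental cycle of
`W_t` forward to `m` times the fundamental cycle of `W'_t`, then `f_* [W_t] = m • [W'_t]` in
`Z_* Y` — because `[W_t] = (ι_t)_* [W_t]`, `[W'_t] = (ι'_t)_* [W'_t]`, `p_t ≫ ι'_t = ι_t ≫ f` and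
push-forward is functorial (Stacks 02R5, `algebraicCycleMap_comp`) and additive. This isolates
the algebraic content of the named fact `map_familyFiberCycle_eq_finrank_smul`
(`Motives/AlgebraicEquivalencePushforwardFacts`) as an identity of cycles on the scheme `W'_t`.
[folklore] -/
theorem map_familyFiberCycle_eq_nsmul_of_fibre (f : X ⟶ Y) [IsProper f.left]
    [IsLocallyNoetherian X.left] [IsLocallyNoetherian Y.left] (W : ClosedSubvariety (X ⊗ T).left)
    (t : AlgPoints T k) (hZ : locallyFinsupp_fundamentalCycleFun.{u}) (m : ℕ)
    (H : AlgebraicCycle.map (familyFiberMap f W t) height height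
        (fundamentalCycle (familyFiber W.toClosedSubscheme t).carrier hZ) =
      m • fundamentalCycle (familyFiber (W.image (f ▷ T).left).toClosedSubscheme t).carrier hZ) :
    AlgebraicCycle.map f.left height height (familyFiberCycle W.toClosedSubscheme t hZ) =
      m • familyFiberCycle (W.image (f ▷ T).left).toClosedSubscheme t hZ := by
  set P := familyFiber W.toClosedSubscheme t with hP
  set P' := familyFiber (W.image (f ▷ T).left).toClosedSubscheme t with hP'
  rw [familyFiberCycle_eq, familyFiberCycle_eq]
  change AlgebraicCycle.map f.left height height
      (AlgebraicCycle.map P.ι height height (fundamentalCycle P.carrier hZ)) =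
    m • AlgebraicCycle.map P'.ι height height (fundamentalCycle P'.carrier hZ)
  rw [← algebraicCycleMap_comp P.ι f.left P.ι.isClosedMap f.left.isClosedMap,
    ← algebraicCycleMap_congr (familyFiberMap_ι f W t),
    algebraicCycleMap_comp (familyFiberMap f W t) P'.ι (familyFiberMap f W t).isClosedMap
      P'.ι.isClosedMap, H, algebraicCycleMap_nsmul]

end Reduction

end Literature.AlgebraicGeometry.Motives

end
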